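import Literature.Analysis.FluidPDE.SawtoothCascadeK2Classical
import Literature.Analysis.FluidPDE.SawtoothCascadeSmooth

/-!
# Parallel shear profiles are exact classical solutions of the Navier–Stokes equations linearised at
# a shear, and are not amplified (route `AnomalousDissipation/SawtoothPulseCascade`, crux K2″
# `K2LinearisedCascadeGrowth`, stmt-AnomalousDissipation-20025 — the parallel half-pulse rung in
# CLASSICAL typing; helper)

On a half-slot the cascade carrier is a shear `ū(t, x) = c(t, x_k) e_m` (`k ≠ m`; H slot: `k = 1`,
`m = 0`, `c = rateH_j(t) U_j`; V slot: `k = 0`, `m = 1`, `c = rateV_j(t) U_j`).  A PARALLEL profile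
`W(t, x) = h(t, x_k) e_m` with `∂ₜh = ν ∂²_y h` (one-sided time derivative within the slot) is an exact
classical solution of the linearised Navier–Stokes equations `∂ₜW + (ū·∇)W + (W·∇)ū = νΔW − ∇0`,
`div W = 0`, with pressure `0`: both transport terms vanish identically (`W` does not depend on `x_m`,
`ū` does not depend on `x_m`, and `W ∥ ū ∥ e_m` has no `e_k` component), and `ΔW = ∂²_y h e_m`.
Consequently (tree energy identity `Torus.linearisedNS_hasDerivWithinAt_integral_norm_sq` with zero
production + the Grönwall barrier `Torus.le_mul_exp_integral_of_deriv_le_mul` at rate `0`) its energy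
is non-increasing, and (tree uniqueness `Torus.linearisedNS_unique`) EVERY classical linearised solution
on the slot whose datum is such a parallel profile coincides with it: an injection parallel to the
running pulse is carried through that half pulse unamplified — the classical form of the registered
BC5 rung `stub_rung_parallelHalfPulse` of K2″ (whose weak-class typing hid an `L^∞L²` uniqueness
theorem), modulo the heat profile `h`, which the consumer supplies (for residual-comb data: the explicit
Fourier series).

§1 is stated for a general shear slot on `𝕋²` (indices `k ≠ m`, time set `S`); §2 specialises to the
H and V half-slots of the cascade `Literature.Analysis.FluidPDE.SawtoothCascade.CascadeParams.field`.
-/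

-- `Summit.<Summit>.<Problem>` is the tree's mandated summit-side namespace (CONVENTIONS §2); for this
-- single-conjunct summit the two coincide, so the duplicate is deliberate (lakefile: off for `Summits`).
set_option linter.dupNamespace false

noncomputable section

namespace Summit.AnomalousDissipation.AnomalousDissipation.Theorems.SawtoothPulseCascade.K2Classical

open Set MeasureTheory
open scoped InnerProductSpace ContDiff
open Literature.Analysis Literature.Analysis.FunctionSpaces Literature.Analysis.FluidPDE
open Literature.Analysis.FluidPDE.SawtoothCascade
open Literature.Analysis.FluidPDE.SawtoothCascade.CascadeParams

/-! ## §1 Parallel shear fields `x ↦ g(x_k) e_m` on `𝕋²` -/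

section General

variable {k m : Fin 2}

/-- A sum over `Fin 2` is the `k`-term plus the `m`-term when `k ≠ m`. -/
private theorem sum_eq_add_of_ne (hkm : k ≠ m) {α : Type*} [AddCommMonoid α] (f : Fin 2 → α) :
    ∑ i, f i = f k + f m := by
  fin_cases k <;> fin_cases m
  · exact absurd rfl hkm
  · simp [Fin.sum_univ_two]
  · simp [Fin.sum_univ_two, add_comm]
  · exact absurd rfl hkm

/-- The `k`-component of `e_m` vanishes for `k ≠ m`. -/
private theorem single_apply_of_ne (hkm : k ≠ m) : EuclideanSpace.single m (1 : ℝ) k = 0 := by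
  simp [hkm]

/-- A parallel shear field `x ↦ g(x_k) e_m` does not vary in the directions `i ≠ k`. -/
theorem partialDeriv_parallelShear_of_ne {g : ℝ → ℝ} (hg : Function.Periodic g 1) {i : Fin 2}
    (hik : i ≠ k) (x : UnitAddTorus (Fin 2)) :
    Torus.partialDeriv i (fun y => g (Torus.repr y k) • EuclideanSpace.single m (1 : ℝ)) x = 0 :=
  Torus.partialDeriv_coordFun_of_ne (g := fun s => g s • EuclideanSpace.single m (1 : ℝ))
    (fun s => by simp only [hg s]) hik x

/-- The `k`-derivative of a parallel shear field `x ↦ g(x_k) e_m` is `g'(x_k) e_m`. -/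
theorem partialDeriv_parallelShear_self {g : ℝ → ℝ} (hg : Function.Periodic g 1)
    (hgd : Differentiable ℝ g) (x : UnitAddTorus (Fin 2)) :
    Torus.partialDeriv k (fun y => g (Torus.repr y k) • EuclideanSpace.single m (1 : ℝ)) x =
      deriv g (Torus.repr x k) • EuclideanSpace.single m (1 : ℝ) := by
  rw [Torus.partialDeriv_coordFun_self (g := fun s => g s • EuclideanSpace.single m (1 : ℝ))
    (fun s => by simp only [hg s]) k x, deriv_smul_const (hgd _)]

/-- A parallel shear field with smooth profile is smooth on `𝕋²`. -/
theorem isSmooth_parallelShear {g : ℝ → ℝ} (hg : Function.Periodic g 1) (hgs : ContDiff ℝ ∞ g) :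
    Torus.IsSmooth (fun y : UnitAddTorus (Fin 2) => g (Torus.repr y k) • EuclideanSpace.single m (1 : ℝ)) := by
  have hl : Torus.lift (fun y : UnitAddTorus (Fin 2) => g (Torus.repr y k) • EuclideanSpace.single m (1 : ℝ)) =
      fun v => g (v k) • EuclideanSpace.single m (1 : ℝ) := by
    funext v
    exact Torus.lift_coordFun_apply (g := fun s => g s • EuclideanSpace.single m (1 : ℝ))
      (fun s => by simp only [hg s]) k v
  have hcoord : ContDiff ℝ ∞ fun v : EuclideanSpace ℝ (Fin 2) => v k := contDiff_euclidean.1 contDiff_id k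
  unfold Torus.IsSmooth
  rw [hl]
  exact (hgs.comp hcoord).smul contDiff_const

/-- A parallel shear field `x ↦ g(x_k) e_m`, `k ≠ m`, is divergence free. -/
theorem isDivFree_parallelShear (hkm : k ≠ m) {g : ℝ → ℝ} (hg : Function.Periodic g 1) :
    Torus.IsDivFree (fun y : UnitAddTorus (Fin 2) => g (Torus.repr y k) • EuclideanSpace.single m (1 : ℝ)) := by
  intro x
  unfold Torus.divergence
  refine Finset.sum_eq_zero fun i _ => ?_
  have hfun : (fun y : UnitAddTorus (Fin 2) => (g (Torus.repr y k) • EuclideanSpace.single m (1 : ℝ)) i) =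
      fun y => (fun s => g s * EuclideanSpace.single m (1 : ℝ) i) (Torus.repr y k) := by
    funext y
    simp only [PiLp.smul_apply, smul_eq_mul]
  rw [hfun]
  by_cases hik : i = k
  · subst hik
    rw [Torus.partialDeriv_coordFun_self (g := fun s => g s * EuclideanSpace.single m (1 : ℝ) i)
      (fun s => by simp only [hg s]) i x, single_apply_of_ne hkm]
    simp
  · exact Torus.partialDeriv_coordFun_of_ne (g := fun s => g s * EuclideanSpace.single m (1 : ℝ) i)
      (fun s => by simp only [hg s]) hik x

/-- The derivative of a `1`-periodic function is `1`-periodic. -/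
private theorem periodic_deriv {g : ℝ → ℝ} (hg : Function.Periodic g 1) : Function.Periodic (deriv g) 1 := by
  intro s
  have h : (fun x => g (x + 1)) = g := funext hg
  rw [← deriv_comp_add_const g 1 s, h]

/-- The Laplacian of a parallel shear field with smooth profile: `Δ (g(x_k) e_m) = g''(x_k) e_m`. -/
theorem laplacian_parallelShear (hkm : k ≠ m) {g : ℝ → ℝ} (hg : Function.Periodic g 1)
    (hgs : ContDiff ℝ ∞ g) (x : UnitAddTorus (Fin 2)) :
    Torus.laplacian (fun y : UnitAddTorus (Fin 2) => g (Torus.repr y k) • EuclideanSpace.single m (1 : ℝ)) x =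
      deriv (deriv g) (Torus.repr x k) • EuclideanSpace.single m (1 : ℝ) := by
  have hgd : Differentiable ℝ g := hgs.differentiable (by simp)
  have hg's : ContDiff ℝ ∞ (deriv g) := by simpa using hgs.iterate_deriv 1
  have hg'd : Differentiable ℝ (deriv g) := hg's.differentiable (by simp)
  rw [Torus.laplacian_eq_sum_partialDeriv_partialDeriv (isSmooth_parallelShear hg hgs) x,
    sum_eq_add_of_ne hkm]
  have h1 : Torus.partialDeriv k (fun y : UnitAddTorus (Fin 2) =>
      g (Torus.repr y k) • EuclideanSpace.single m (1 : ℝ)) =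
      fun y => deriv g (Torus.repr y k) • EuclideanSpace.single m (1 : ℝ) :=
    funext fun y => partialDeriv_parallelShear_self hg hgd y
  have h2 : Torus.partialDeriv m (fun y : UnitAddTorus (Fin 2) =>
      g (Torus.repr y k) • EuclideanSpace.single m (1 : ℝ)) = fun _ => 0 :=
    funext fun y => partialDeriv_parallelShear_of_ne hg (Ne.symm hkm) y
  rw [h1, h2, partialDeriv_parallelShear_self (periodic_deriv hg) hg'd x]
  simp [Torus.partialDeriv, Torus.lineDeriv]

/-- **Transport of a parallel field by the shear vanishes**: `(ū·∇)W = 0` for `ū = c(x_k) e_m`,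
`W = g(x_k) e_m`, `k ≠ m` (`ū` has no `e_k` component and `W` does not vary along `e_m`). -/
theorem convect_shear_parallelShear (hkm : k ≠ m) {c g : ℝ → ℝ} (hg : Function.Periodic g 1)
    (hgs : ContDiff ℝ ∞ g) (x : UnitAddTorus (Fin 2)) :
    Torus.convect (fun y : UnitAddTorus (Fin 2) => c (Torus.repr y k) • EuclideanSpace.single m (1 : ℝ))
      (fun y => g (Torus.repr y k) • EuclideanSpace.single m (1 : ℝ)) x = 0 := by
  unfold Torus.convect
  rw [Torus.fderiv_apply_eq_sum_partialDeriv ((isSmooth_parallelShear hg hgs).isContDiff (by simp)) x,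
    sum_eq_add_of_ne hkm, partialDeriv_parallelShear_of_ne hg (Ne.symm hkm) x]
  simp only [PiLp.smul_apply, smul_eq_mul, single_apply_of_ne hkm, mul_zero, zero_smul, smul_zero,
    add_zero]

/-- **Stretching of the shear by a parallel field vanishes**: `(W·∇)ū = 0` for `ū = c(x_k) e_m`,
`W = g(x_k) e_m`, `k ≠ m` (`W` has no `e_k` component and `ū` does not vary along `e_m`). -/
theorem convect_parallelShear_shear (hkm : k ≠ m) {c g : ℝ → ℝ} (hc : Function.Periodic c 1)
    (hcs : ContDiff ℝ ∞ c) (x : UnitAddTorus (Fin 2)) :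
    Torus.convect (fun y : UnitAddTorus (Fin 2) => g (Torus.repr y k) • EuclideanSpace.single m (1 : ℝ))
      (fun y => c (Torus.repr y k) • EuclideanSpace.single m (1 : ℝ)) x = 0 := by
  unfold Torus.convect
  rw [Torus.fderiv_apply_eq_sum_partialDeriv ((isSmooth_parallelShear hc hcs).isContDiff (by simp)) x,
    sum_eq_add_of_ne hkm, partialDeriv_parallelShear_of_ne hc (Ne.symm hkm) x]
  simp only [PiLp.smul_apply, smul_eq_mul, single_apply_of_ne hkm, mul_zero, zero_smul, smul_zero,
    add_zero]

/-- The pressure gradient of the zero pressure vanishes. -/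
theorem gradient_zero_fun (x : UnitAddTorus (Fin 2)) :
    Torus.gradient (fun _ : UnitAddTorus (Fin 2) => (0 : ℝ)) x = 0 := by
  show _root_.gradient (fun _ : EuclideanSpace ℝ (Fin 2) => (0 : ℝ)) 0 = 0
  exact gradient_fun_const _ _

/-! ### Time-dependent parallel profiles `W(t, x) = h(t, x_k) e_m` -/

/-- A time-dependent parallel shear field with jointly smooth profile is jointly smooth. -/
theorem isSmoothSpaceTimeOn_parallelShear {S : Set ℝ} {h : ℝ → ℝ → ℝ}
    (hh : ContDiffOn ℝ ∞ (Function.uncurry h) (S ×ˢ univ)) (hper : ∀ t ∈ S, Function.Periodic (h t) 1) :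
    Torus.IsSmoothSpaceTimeOn S
      (fun t (y : UnitAddTorus (Fin 2)) => h t (Torus.repr y k) • EuclideanSpace.single m (1 : ℝ)) := by
  have hcoord : ContDiff ℝ ∞ fun v : EuclideanSpace ℝ (Fin 2) => v k := contDiff_euclidean.1 contDiff_id k
  have hcomp : ContDiffOn ℝ ∞ (fun z : ℝ × EuclideanSpace ℝ (Fin 2) => Function.uncurry h (z.1, z.2 k))
      (S ×ˢ univ) := by
    refine hh.comp (contDiffOn_fst.prodMk ((hcoord.comp contDiff_snd).contDiffOn)) ?_
    intro z hz
    exact mk_mem_prod (mem_prod.1 hz).1 (mem_univ _)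
  have hΦ : ContDiffOn ℝ ∞ (fun z : ℝ × EuclideanSpace ℝ (Fin 2) =>
      Function.uncurry h (z.1, z.2 k) • EuclideanSpace.single m (1 : ℝ)) (S ×ˢ univ) :=
    hcomp.smul contDiffOn_const
  unfold Torus.IsSmoothSpaceTimeOn
  refine hΦ.congr fun z hz => ?_
  rw [Torus.stLift_apply]
  have h1 := Torus.lift_coordFun_apply (g := fun s => h z.1 s • EuclideanSpace.single m (1 : ℝ))
    (fun s => by simp only [hper z.1 (mem_prod.1 hz).1 s]) k z.2
  rw [Torus.lift_apply] at h1
  exact h1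

/-- Time slices of a jointly smooth profile are smooth. -/
theorem contDiff_slice_of_contDiffOn_uncurry {S : Set ℝ} {h : ℝ → ℝ → ℝ}
    (hh : ContDiffOn ℝ ∞ (Function.uncurry h) (S ×ˢ univ)) {t : ℝ} (ht : t ∈ S) :
    ContDiff ℝ ∞ (h t) :=
  hh.comp_contDiff (contDiff_prodMk_right t) fun y => mk_mem_prod ht (mem_univ y)

/-- The one-sided time derivative of `W(t, x) = h(t, x_k) e_m` within a time set of unique
differentiability is `∂ₜ|_S h(t, x_k) e_m`. -/
theorem timeDerivWithin_parallelShear {S : Set ℝ} (hS : UniqueDiffOn ℝ S) {h : ℝ → ℝ → ℝ}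
    (hh : ContDiffOn ℝ ∞ (Function.uncurry h) (S ×ˢ univ)) {t : ℝ} (ht : t ∈ S)
    (x : UnitAddTorus (Fin 2)) :
    Torus.timeDerivWithin S
        (fun τ (y : UnitAddTorus (Fin 2)) => h τ (Torus.repr y k) • EuclideanSpace.single m (1 : ℝ)) t x =
      derivWithin (fun τ => h τ (Torus.repr x k)) S t • EuclideanSpace.single m (1 : ℝ) := by
  have hd : DifferentiableWithinAt ℝ (fun τ => h τ (Torus.repr x k)) S t := by
    have h1 : DifferentiableWithinAt ℝ (Function.uncurry h) (S ×ˢ univ) (t, Torus.repr x k) :=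
      hh.differentiableOn (by simp) (t, Torus.repr x k) (mk_mem_prod ht (mem_univ _))
    have h2 : DifferentiableWithinAt ℝ (fun τ : ℝ => (τ, Torus.repr x k)) S t :=
      differentiableWithinAt_id.prodMk (differentiableWithinAt_const _)
    exact h1.comp t h2 fun τ hτ => mk_mem_prod hτ (mem_univ _)
  exact (hd.hasDerivWithinAt.smul_const (EuclideanSpace.single m (1 : ℝ))).derivWithin (hS t ht)

/-- **Parallel heat profiles solve the linearised Navier–Stokes equations along a shear.** Let `k ≠ m`,
`S` a time set of unique differentiability, `ū(t, x) = c(t, x_k) e_m` on `S` with `c(t, ·)` smooth and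
`1`-periodic, and `h` jointly smooth on `S × ℝ`, `1`-periodic in space, with `∂ₜ|_S h = ν ∂²_y h`.  Then
`W(t, x) = h(t, x_k) e_m` satisfies, with pressure `0`,
`∂ₜ|_S W + (ū·∇)W + (W·∇)ū = νΔW − ∇0` on `S × 𝕋²`. -/
theorem linearisedNS_parallelShear (hkm : k ≠ m) {S : Set ℝ} (hS : UniqueDiffOn ℝ S) {ν : ℝ}
    {u : ℝ → UnitAddTorus (Fin 2) → EuclideanSpace ℝ (Fin 2)} {c : ℝ → ℝ → ℝ}
    (hu : ∀ t ∈ S, u t = fun y => c t (Torus.repr y k) • EuclideanSpace.single m (1 : ℝ))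
    (hcper : ∀ t ∈ S, Function.Periodic (c t) 1) (hcs : ∀ t ∈ S, ContDiff ℝ ∞ (c t))
    {h : ℝ → ℝ → ℝ} (hh : ContDiffOn ℝ ∞ (Function.uncurry h) (S ×ˢ univ))
    (hper : ∀ t ∈ S, Function.Periodic (h t) 1)
    (heat : ∀ t ∈ S, ∀ y, derivWithin (fun τ => h τ y) S t = ν * deriv (deriv (h t)) y) :
    ∀ t ∈ S, ∀ x,
      Torus.timeDerivWithin S
          (fun τ (y : UnitAddTorus (Fin 2)) => h τ (Torus.repr y k) • EuclideanSpace.single m (1 : ℝ)) t x +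
        Torus.convect (u t) (fun y => h t (Torus.repr y k) • EuclideanSpace.single m (1 : ℝ)) x +
        Torus.convect (fun y => h t (Torus.repr y k) • EuclideanSpace.single m (1 : ℝ)) (u t) x =
      ν • Torus.laplacian (fun y => h t (Torus.repr y k) • EuclideanSpace.single m (1 : ℝ)) x -
        Torus.gradient (fun _ : UnitAddTorus (Fin 2) => (0 : ℝ)) x := by
  intro t ht x
  have hhs := contDiff_slice_of_contDiffOn_uncurry hh ht
  rw [timeDerivWithin_parallelShear hS hh ht x, hu t ht,
    convect_shear_parallelShear hkm (hper t ht) hhs x,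
    convect_parallelShear_shear hkm (hcper t ht) (hcs t ht) x,
    laplacian_parallelShear hkm (hper t ht) hhs x, gradient_zero_fun x, heat t ht]
  rw [add_zero, add_zero, sub_zero, smul_smul]

/-- **Parallel heat profiles are not amplified.** In the setting of `linearisedNS_parallelShear` on a
compact slot `S = [a, b]`, `a < b`, with `ν ≥ 0` and the carrier jointly smooth and divergence free
there, the energy of `W(t) = h(t, x_k) e_m` is non-increasing: `‖W(t)‖²_{L²} ≤ ‖W(a)‖²_{L²}` on `[a, b]`
(energy identity with vanishing production `⟪(W·∇)ū, W⟫ = 0`, Grönwall at rate `0`). -/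
theorem vectorL2Sq_parallelShear_le (hkm : k ≠ m) {a b : ℝ} (hab : a < b) {ν : ℝ} (hν : 0 ≤ ν)
    {u : ℝ → UnitAddTorus (Fin 2) → EuclideanSpace ℝ (Fin 2)} {c : ℝ → ℝ → ℝ}
    (husm : Torus.IsSmoothSpaceTimeOn (Icc a b) u) (hudiv : ∀ t ∈ Icc a b, Torus.IsDivFree (u t))
    (hu : ∀ t ∈ Icc a b, u t = fun y => c t (Torus.repr y k) • EuclideanSpace.single m (1 : ℝ))
    (hcper : ∀ t ∈ Icc a b, Function.Periodic (c t) 1) (hcs : ∀ t ∈ Icc a b, ContDiff ℝ ∞ (c t))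
    {h : ℝ → ℝ → ℝ} (hh : ContDiffOn ℝ ∞ (Function.uncurry h) (Icc a b ×ˢ univ))
    (hper : ∀ t ∈ Icc a b, Function.Periodic (h t) 1)
    (heat : ∀ t ∈ Icc a b, ∀ y, derivWithin (fun τ => h τ y) (Icc a b) t = ν * deriv (deriv (h t)) y)
    {t : ℝ} (ht : t ∈ Icc a b) :
    Torus.vectorL2Sq (fun y : UnitAddTorus (Fin 2) => h t (Torus.repr y k) • EuclideanSpace.single m (1 : ℝ)) ≤
      Torus.vectorL2Sq (fun y : UnitAddTorus (Fin 2) => h a (Torus.repr y k) • EuclideanSpace.single m (1 : ℝ)) := by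
  set W : ℝ → UnitAddTorus (Fin 2) → EuclideanSpace ℝ (Fin 2) :=
    fun τ y => h τ (Torus.repr y k) • EuclideanSpace.single m (1 : ℝ) with hW
  have hWs : Torus.IsSmoothSpaceTimeOn (Icc a b) W := isSmoothSpaceTimeOn_parallelShear hh hper
  have hqs : Torus.IsSmoothSpaceTimeOn (Icc a b) (fun (_ : ℝ) (_ : UnitAddTorus (Fin 2)) => (0 : ℝ)) :=
    Torus.isSmoothSpaceTimeOn_const (Torus.isSmooth_const (0 : ℝ)) _
  have hWdiv : ∀ s ∈ Icc a b, Torus.IsDivFree (W s) := fun s hs => isDivFree_parallelShear hkm (hper s hs)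
  have hlin := linearisedNS_parallelShear hkm (uniqueDiffOn_Icc hab) hu hcper hcs hh hper heat
  have hE : ∀ s ∈ Icc a b, HasDerivWithinAt (fun s => ∫ x, ‖W s x‖ ^ 2)
      (-(2 * ν * Torus.gradNormSq (W s)) - 2 * ∫ x, ⟪Torus.convect (W s) (u s) x, W s x⟫_ℝ) (Icc a b) s :=
    fun s hs => Torus.linearisedNS_hasDerivWithinAt_integral_norm_sq husm hudiv hWs hqs hWdiv hlin hab hs
  have hle : ∀ s ∈ Icc a b,
      -(2 * ν * Torus.gradNormSq (W s)) - 2 * ∫ x, ⟪Torus.convect (W s) (u s) x, W s x⟫_ℝ ≤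
        0 * ∫ x, ‖W s x‖ ^ 2 := by
    intro s hs
    have h0 : ∫ x, ⟪Torus.convect (W s) (u s) x, W s x⟫_ℝ = 0 := by
      have hpt : (fun x => ⟪Torus.convect (W s) (u s) x, W s x⟫_ℝ) = fun _ => 0 := by
        funext x
        simp only [hW]
        rw [hu s hs, convect_parallelShear_shear hkm (hcper s hs) (hcs s hs) x, inner_zero_left]
      rw [hpt, integral_zero]
    rw [h0, mul_zero, sub_zero, zero_mul, neg_nonpos]
    exact mul_nonneg (mul_nonneg two_pos.le hν) (Torus.gradNormSq_nonneg _)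
  have h := Torus.le_mul_exp_integral_of_deriv_le_mul hE hle continuousOn_const ht
  simp only [intervalIntegral.integral_zero, Real.exp_zero, mul_one] at h
  exact h

end General

end Summit.AnomalousDissipation.AnomalousDissipation.Theorems.SawtoothPulseCascade.K2Classical

end
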